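import Mathlib
import Literature.NumberTheory.Automorphic.AutomorphicKernel

/-!
# Invariant integral operators on `ℍ` and the eigenvalue `h(t)` on `y^s`
(Iwaniec, *Spectral Methods of Automorphic Forms*, GSM 53, §1.8 (invariant integral operators,
PDF pp. 20–21), (1.62) and Theorem 1.16, PDF p. 24; §7.2, PDF p. 73)

Eleventh layer of the `provefact` decomposition of `Literature.NumberTheory.Automorphic.sl2BallCount_asymp`
(`HyperbolicLatticeCount.lean`), and the second brick (after `InvariantLaplacian.lean`) of the
spectral theory of `L²(SL₂(ℤ)\ℍ)` behind the remaining named fact `Iwaniec2002_thm_7_4_modular`: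
the invariant integral operators `(L_k f)(z) = ∫_ℍ k(u(z, w)) f(w) dμ(w)` and the computation at
the heart of Theorem 1.16 — on the eigenfunction `(Im w)^s`, `s = 1/2 + it`, `L_k` acts by the
Selberg/Harish-Chandra transform `h(t)` of (1.62). Everything here is proved; nothing is vendored.

1. Integration over `ℍ` in coordinates: `∫_ℍ f dμ = ∫_{y>0} ∫_ℝ f(x + iy) y⁻² dx dy` ((1.8);
   `integral_upperHalfPlane_eq_integral_complex`, `setIntegral_upperHalf_eq_iterated`, and the
   integrability dictionary), `u(z, w)` in coordinates ((1.4)).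
2. `invariantOperator k f z = ∫ k(u(z, w)) f(w) dμ(w)` (the operator `L` opening §1.8, p. 20, with
   point-pair invariant kernel `k(z, w) = k(u(z, w))`, p. 21); invariance
   `L_k(f ∘ g) = (L_k f) ∘ g` for `g ∈ SL₂(ℝ)` (§1.8), absolute convergence for test kernels
   (bounded, compactly supported: `IsTestKernel` of `SelbergTransform.lean`) against locally
   integrable `f`, and the bound `|L_k f(z)| ≤ B ∫_{ball} |f|`.
3. The fibre integral `∫_ℝ k(((x - x₀)² + c)/(4y₀y)) dx = 2√(y₀y) q(c/(4y₀y))` (the substitution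
   `x = 2√(uy)` of the proof of Theorem 1.16) and the substitution `y = y₀ e^r`.
4. **`invariantOperator_im_cpow`**: `∫_ℍ k(u(z, w)) (Im w)^{1/2+it} dμ(w) = h(t) (Im z)^{1/2+it}` for
   every test kernel `k`, `t ∈ ℂ`, `z ∈ ℍ` (Theorem 1.16 on `y^s`, proof as printed); hence the
   integral representation `h(t) = ∫_ℍ k(u(i, w)) (Im w)^{1/2+it} dμ(w)` of p. 73, the same for
   `(Im gw)^s`, and the area formula `∫_ℍ k(u(z, w)) dμ(w) = 4π ∫_0^∞ k(u) du = h(i/2)` (eigenvalue on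
   constants; the main term of Theorems 7.4/12.1).

Mathlib: the hyperbolic measure `UpperHalfPlane.volume_def` (density `y⁻²` on the comap of
Lebesgue measure) with `SMulInvariantMeasure (GL (Fin 2) ℝ) ℍ volume` and
`MeasureTheory.integral_smul_eq_self`; `IsometricSMul SL(2, ℝ) ℍ`, `ProperSpace ℍ`;
`integral_image_eq_integral_abs_deriv_smul` (substitutions), `integral_prod_symm` (Fubini),
`MeasurableEmbedding.integrableOn_range_iff_comap`, `integrable_withDensity_iff_integrable_smul`.
Literature: `pointPairInv`, `pointPairInv_smul`, `dist_le_of_pointPairInv_le`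
(`HyperbolicLatticeCount.lean`, `AutomorphicKernel.lean`); `selbergQ/G/Transform`,
`IsTestKernel`, `selbergTransform_I_half` (`SelbergTransform.lean`). No invariant integral
operator on `ℍ` exists in Mathlib or Literature (`lean search 'invariantOperator|integralOperator'`:
none; Mathlib's `MeasureTheory.Integral.CircleAverage` is the Euclidean circle mean).
-/

noncomputable section

namespace Literature.NumberTheory.Automorphic

open MeasureTheory Set Filter Real UpperHalfPlane
open scoped Topology NNReal MatrixGroups

/-! ## 1. Integration over `ℍ` in the coordinates `z = x + iy` -/

section Coordinates

/-- The density `y⁻²` of the hyperbolic measure (as an `ℝ≥0`-valued function on `ℍ`) is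
measurable. [folklore] -/
theorem measurable_hypDensity :
    Measurable fun z : ℍ => ((1 / NNReal.mk z.im z.im_pos.le : ℝ≥0) ^ 2) := by
  refine Continuous.measurable ?_
  refine .pow (.div₀ continuous_const ?_ ?_) _
  · exact UpperHalfPlane.continuous_im.subtype_mk _
  · exact fun x ↦ NNReal.ne_iff.mp x.im_ne_zero

/-- **The hyperbolic integral in Euclidean coordinates**: `∫_ℍ f dμ = ∫_{Im z > 0} f(z) y⁻² dx dy`
(`dμ = y⁻² dx dy`, Iwaniec (1.8)). Unconditional (both sides are Bochner integrals, `0` when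
divergent). [cite: Iwaniec2002, (1.8), PDF p. 10] -/
theorem integral_upperHalfPlane_eq_integral_complex {E : Type*} [NormedAddCommGroup E]
    [NormedSpace ℝ E] (f : ℍ → E) :
    ∫ w, f w = ∫ z in {z : ℂ | 0 < z.im}, ((z.im ^ 2)⁻¹ : ℝ) • f (ofComplex z) := by
  rw [UpperHalfPlane.volume_def, integral_withDensity_eq_integral_smul measurable_hypDensity]
  set g : ℂ → E := fun z => ((z.im ^ 2)⁻¹ : ℝ) • f (ofComplex z) with hg
  have e1 : (fun w : ℍ => ((1 / NNReal.mk w.im w.im_pos.le) ^ 2 : ℝ≥0) • f w) = fun w : ℍ => g (w : ℂ) := by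
    funext w
    simp only [hg]
    rw [ofComplex_apply, NNReal.smul_def]
    congr 1
    simp [NNReal.coe_pow]
  rw [e1, ← measurableEmbedding_coe.integral_map g, measurableEmbedding_coe.map_comap,
    _root_.UpperHalfPlane.range_coe]

/-- Integrability transfers along the same dictionary: `f ∈ L¹(ℍ, dμ)` iff
`z ↦ y⁻² f(z)` is integrable on `{Im z > 0}` for Lebesgue measure. [folklore] -/
theorem integrable_upperHalfPlane_iff_integrableOn_complex {E : Type*} [NormedAddCommGroup E]
    [NormedSpace ℝ E] (f : ℍ → E) :
    Integrable f ↔ IntegrableOn (fun z : ℂ => ((z.im ^ 2)⁻¹ : ℝ) • f (ofComplex z)) {z : ℂ | 0 < z.im} := by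
  rw [show {z : ℂ | 0 < z.im} = range UpperHalfPlane.coe from _root_.UpperHalfPlane.range_coe.symm,
    UpperHalfPlane.volume_def, integrable_withDensity_iff_integrable_smul measurable_hypDensity,
    measurableEmbedding_coe.integrableOn_range_iff_comap]
  have e1 : (fun w : ℍ => ((1 / NNReal.mk w.im w.im_pos.le) ^ 2 : ℝ≥0) • f w) =
      (fun z : ℂ => ((z.im ^ 2)⁻¹ : ℝ) • f (ofComplex z)) ∘ UpperHalfPlane.coe := by
    funext w
    simp only [Function.comp_apply]
    rw [ofComplex_apply, NNReal.smul_def]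
    congr 1
    simp [NNReal.coe_pow]
  rw [e1]

/-- The open upper half-plane as a preimage under `ℂ ≃ᵐ ℝ × ℝ`. [folklore] -/
theorem upperHalf_eq_preimage :
    {z : ℂ | 0 < z.im} = Complex.measurableEquivRealProd ⁻¹' (univ ×ˢ Ioi (0 : ℝ)) := by
  ext z; simp [Complex.measurableEquivRealProd_apply]

/-- Fubini over the upper half-plane, `y` outside: `∫_{Im z>0} g dA = ∫_0^∞ ∫_ℝ g(x + iy) dx dy`
for `g` integrable on `{Im z > 0}`. [folklore] -/
theorem setIntegral_upperHalf_eq_iterated {E : Type*} [NormedAddCommGroup E] [NormedSpace ℝ E]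
    (g : ℂ → E) (hg : IntegrableOn g {z : ℂ | 0 < z.im}) :
    ∫ z in {z : ℂ | 0 < z.im}, g z = ∫ y in Ioi (0 : ℝ), ∫ x : ℝ, g ⟨x, y⟩ := by
  have hmp := Complex.volume_preserving_equiv_real_prod
  have hme := Complex.measurableEquivRealProd.measurableEmbedding
  set G : ℝ × ℝ → E := fun p => g ⟨p.1, p.2⟩ with hG
  have h1 : ∫ z in {z : ℂ | 0 < z.im}, g z = ∫ p in univ ×ˢ Ioi (0 : ℝ), G p ∂(volume.prod volume) := by
    rw [upperHalf_eq_preimage, ← Measure.volume_eq_prod, ← hmp.setIntegral_preimage_emb hme]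
    rfl
  have hGi : IntegrableOn G (univ ×ˢ Ioi (0 : ℝ)) (volume.prod volume) := by
    rw [← Measure.volume_eq_prod, ← hmp.integrableOn_comp_preimage hme, ← upperHalf_eq_preimage]
    exact hg
  rw [IntegrableOn, ← Measure.prod_restrict, Measure.restrict_univ] at hGi
  rw [h1, ← Measure.prod_restrict, Measure.restrict_univ]
  exact integral_prod_symm G hGi

/-- The point-pair invariant in coordinates: for `w = x + iy`,
`u(z, w) = ((x - Re z)² + (y - Im z)²) / (4 Im z · y)`. [cite: Iwaniec2002, (1.4), PDF p. 9] -/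
theorem pointPairInv_eq_coord (z w : ℍ) :
    pointPairInv z w = ((w.re - z.re) ^ 2 + (w.im - z.im) ^ 2) / (4 * z.im * w.im) := by
  unfold pointPairInv
  rw [Complex.dist_eq, Complex.sq_norm, Complex.normSq_apply]
  simp only [Complex.sub_re, Complex.sub_im, UpperHalfPlane.coe_re, UpperHalfPlane.coe_im]
  ring

/-- The same at a point `p` of the open upper half-plane, through `ofComplex`. [folklore] -/
theorem pointPairInv_ofComplex (z : ℍ) {p : ℂ} (hp : 0 < p.im) :
    pointPairInv z (ofComplex p) = ((p.re - z.re) ^ 2 + (p.im - z.im) ^ 2) / (4 * z.im * p.im) := by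
  rw [pointPairInv_eq_coord, ofComplex_apply_of_im_pos hp]
  rfl

end Coordinates

/-! ## 2. Invariant integral operators -/

section Operator

/-- **The invariant integral operator with point-pair invariant kernel `k(u(z, w))`** (Iwaniec
§1.8: the operator `(Lf)(z) = ∫_ℍ k(z, w) f(w) dμw` of the display opening §1.8, p. 20, with a
point-pair invariant kernel `k(z, w) = k(u(z, w))`, p. 21): `(L_k f)(z) = ∫_ℍ k(u(z, w)) f(w) dμ(w)`,
`dμ` the hyperbolic measure.
(Bochner integral: `0` if divergent; for a test kernel `k` — bounded, compactly supported — and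
`f` locally integrable it converges absolutely, `integrable_kernel_mul`.)
[cite: Iwaniec2002, §1.8, PDF pp. 20–21] -/
def invariantOperator (k : ℝ → ℝ) (f : ℍ → ℂ) (z : ℍ) : ℂ :=
  ∫ w : ℍ, (k (pointPairInv z w) : ℂ) * f w

variable {k : ℝ → ℝ}

/-- Unfolding lemma. [folklore] -/
theorem invariantOperator_apply (k : ℝ → ℝ) (f : ℍ → ℂ) (z : ℍ) :
    invariantOperator k f z = ∫ w : ℍ, (k (pointPairInv z w) : ℂ) * f w := rfl

/-- The action of `g ∈ SL₂(ℝ)` on `ℍ` through `GL₂(ℝ)` is the `SL₂(ℝ)`-action. [folklore] -/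
theorem toGL_smul_eq (g : SL(2, ℝ)) (w : ℍ) :
    (Matrix.SpecialLinearGroup.toGL g : GL (Fin 2) ℝ) • w = g • w := rfl

/-- **Invariance** (Iwaniec §1.8: `L` commutes with all `T_g`, `L(f(g·))(z) = (Lf)(gz)`): for
`g ∈ SL₂(ℝ)`, `L_k (f ∘ g) = (L_k f) ∘ g`. (The hyperbolic measure is `SL₂(ℝ)`-invariant and
`u(gz, gw) = u(z, w)`.) [cite: Iwaniec2002, §1.8, PDF pp. 20–21] -/
theorem invariantOperator_comp_smul (k : ℝ → ℝ) (f : ℍ → ℂ) (g : SL(2, ℝ)) (z : ℍ) :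
    invariantOperator k (fun w => f (g • w)) z = invariantOperator k f (g • z) := by
  unfold invariantOperator
  symm
  calc ∫ w : ℍ, (k (pointPairInv (g • z) w) : ℂ) * f w
      = ∫ w : ℍ, (k (pointPairInv (g • z) ((Matrix.SpecialLinearGroup.toGL g : GL (Fin 2) ℝ) • w)) : ℂ) *
          f ((Matrix.SpecialLinearGroup.toGL g : GL (Fin 2) ℝ) • w) :=
        (integral_smul_eq_self (μ := (volume : Measure ℍ))
          (fun w : ℍ => (k (pointPairInv (g • z) w) : ℂ) * f w)).symm
    _ = ∫ w : ℍ, (k (pointPairInv z w) : ℂ) * f (g • w) := by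
        congr 1 with w
        rw [toGL_smul_eq, pointPairInv_smul]

/-- `w ↦ u(z, w)` is continuous. [folklore] -/
theorem continuous_pointPairInv (z : ℍ) : Continuous fun w : ℍ => pointPairInv z w := by
  unfold pointPairInv
  refine Continuous.div ((continuous_const.dist UpperHalfPlane.continuous_coe).pow 2)
    (continuous_const.mul UpperHalfPlane.continuous_im) fun w => ?_
  have := z.im_pos; have := w.im_pos; positivity

/-- The kernel `w ↦ k(u(z, w))` of a measurable `k` is measurable. [folklore] -/
theorem measurable_kernel (hk : Measurable k) (z : ℍ) :
    Measurable fun w : ℍ => k (pointPairInv z w) :=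
  hk.comp (continuous_pointPairInv z).measurable

/-- A test kernel vanishes outside the hyperbolic ball of radius `2 arsinh √M` about `z`.
[folklore] -/
theorem kernel_eq_zero_of_dist {M : ℝ} (hM : ∀ u, M ≤ u → k u = 0) {z w : ℍ}
    (hw : 2 * Real.arsinh (Real.sqrt M) < dist z w) : k (pointPairInv z w) = 0 := by
  apply hM
  by_contra h
  exact absurd (dist_le_of_pointPairInv_le (not_le.mp h).le) (not_le.mpr hw)

/-- **Absolute convergence** of `(L_k f)(z)` for a test kernel `k` (bounded, vanishing for
`u ≥ M`) and `f` locally integrable on `ℍ`: the integrand is supported in the compact ball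
`ρ(z, w) ≤ 2 arsinh √M`. (Iwaniec, p. 21: "we always assume ... that the integral converges
absolutely".) [cite: Iwaniec2002, §1.8, PDF p. 21] -/
theorem integrable_kernel_mul (hk : IsTestKernel k) {f : ℍ → ℂ} (hf : LocallyIntegrable f) (z : ℍ) :
    Integrable fun w : ℍ => (k (pointPairInv z w) : ℂ) * f w := by
  obtain ⟨hkm, ⟨B, hB⟩, ⟨M, hM0, hM⟩⟩ := hk
  set R : ℝ := 2 * Real.arsinh (Real.sqrt M)
  have hK : IsCompact (Metric.closedBall z R) := isCompact_closedBall z R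
  have h1 : IntegrableOn (fun w : ℍ => (k (pointPairInv z w) : ℂ) * f w) (Metric.closedBall z R) := by
    have hfK : IntegrableOn f (Metric.closedBall z R) := hf.integrableOn_isCompact hK
    refine Integrable.bdd_mul (c := B) hfK ?_ ?_
    · exact (Complex.measurable_ofReal.comp (measurable_kernel hkm z)).aestronglyMeasurable
    · refine Eventually.of_forall fun w => ?_
      rw [Complex.norm_real, Real.norm_eq_abs]
      exact hB _
  refine h1.integrable_of_forall_notMem_eq_zero fun w hw => ?_
  rw [Metric.mem_closedBall, not_le, dist_comm] at hw
  rw [kernel_eq_zero_of_dist hM hw]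
  simp

/-- In particular `L_k f` converges for continuous `f`. [folklore] -/
theorem integrable_kernel_mul_of_continuous (hk : IsTestKernel k) {f : ℍ → ℂ} (hf : Continuous f)
    (z : ℍ) : Integrable fun w : ℍ => (k (pointPairInv z w) : ℂ) * f w :=
  integrable_kernel_mul hk hf.locallyIntegrable z

/-- Invariance for elements of the image of `SL₂(ℝ)` in `GL₂(ℝ)` (the ambient group of the
`Literature` subgroups `Γ ≤ GL (Fin 2) ℝ`, e.g. `𝒮ℒ`). [cite: Iwaniec2002, §1.8, PDF pp. 20–21] -/
theorem invariantOperator_comp_smul_of_mem_range (k : ℝ → ℝ) (f : ℍ → ℂ) {γ : GL (Fin 2) ℝ}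
    (hγ : γ ∈ (Matrix.SpecialLinearGroup.toGL : SL(2, ℝ) →* GL (Fin 2) ℝ).range) (z : ℍ) :
    invariantOperator k (fun w => f (γ • w)) z = invariantOperator k f (γ • z) := by
  obtain ⟨g, rfl⟩ := hγ
  exact invariantOperator_comp_smul k f g z

/-- `L_k` is linear: compatible with scalars. [folklore] -/
theorem invariantOperator_const_mul (k : ℝ → ℝ) (c : ℂ) (f : ℍ → ℂ) (z : ℍ) :
    invariantOperator k (fun w => c * f w) z = c * invariantOperator k f z := by
  unfold invariantOperator
  rw [← integral_const_mul]
  congr 1 with w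
  ring

/-- A crude bound: `|(L_k f)(z)| ≤ B ∫_{ρ(z,w) ≤ 2 arsinh √M} |f| dμ` for `|k| ≤ B` vanishing beyond
`M` and `f` locally integrable. [folklore] -/
theorem norm_invariantOperator_le {B M : ℝ} (hB : ∀ u, |k u| ≤ B)
    (hM : ∀ u, M ≤ u → k u = 0) {f : ℍ → ℂ} (hf : LocallyIntegrable f) (z : ℍ) :
    ‖invariantOperator k f z‖ ≤
      B * ∫ w in Metric.closedBall z (2 * Real.arsinh (Real.sqrt M)), ‖f w‖ := by
  set R : ℝ := 2 * Real.arsinh (Real.sqrt M)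
  have hfi : IntegrableOn (fun w => ‖f w‖) (Metric.closedBall z R) :=
    (hf.integrableOn_isCompact (isCompact_closedBall z R)).norm
  unfold invariantOperator
  have e : (fun w : ℍ => (k (pointPairInv z w) : ℂ) * f w) =
      (Metric.closedBall z R).indicator (fun w : ℍ => (k (pointPairInv z w) : ℂ) * f w) := by
    funext w
    by_cases hw : w ∈ Metric.closedBall z R
    · rw [indicator_of_mem hw]
    · rw [indicator_of_notMem hw]
      rw [Metric.mem_closedBall, not_le, dist_comm] at hw
      rw [kernel_eq_zero_of_dist hM hw]
      simp
  rw [e, integral_indicator Metric.isClosed_closedBall.measurableSet]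
  calc ‖∫ w in Metric.closedBall z R, (k (pointPairInv z w) : ℂ) * f w‖
      ≤ ∫ w in Metric.closedBall z R, ‖(k (pointPairInv z w) : ℂ) * f w‖ := norm_integral_le_integral_norm _
    _ ≤ ∫ w in Metric.closedBall z R, B * ‖f w‖ := by
        refine integral_mono_of_nonneg (Eventually.of_forall fun w => norm_nonneg _) (hfi.const_mul B) ?_
        refine Eventually.of_forall fun w => ?_
        simp only
        rw [norm_mul, Complex.norm_real, Real.norm_eq_abs]
        exact mul_le_mul_of_nonneg_right (hB _) (norm_nonneg _)
    _ = B * ∫ w in Metric.closedBall z R, ‖f w‖ := integral_const_mul _ _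

end Operator

/-! ## 3. The fibre integral: `∫_ℝ k(((x-x₀)² + c)/(4y₀y)) dx = 2 √(y₀ y) q(c/(4 y₀ y))` -/

section Fibre

variable {k : ℝ → ℝ}

/-- The substitution `x = 2√(y₀ y (u - v))` maps `(v, ∞)` onto `(0, ∞)`. [folklore] -/
theorem image_fibreSubst {P v : ℝ} (hP : 0 < P) :
    (fun u => 2 * Real.sqrt (P * (u - v))) '' Ioi v = Ioi 0 := by
  ext x
  simp only [mem_image, mem_Ioi]
  constructor
  · rintro ⟨u, hu, rfl⟩
    have : 0 < P * (u - v) := mul_pos hP (by linarith)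
    positivity
  · intro hx
    refine ⟨v + x ^ 2 / (4 * P), by have : 0 < x ^ 2 / (4 * P) := by positivity
                                    linarith, ?_⟩
    have e : P * (v + x ^ 2 / (4 * P) - v) = (x / 2) ^ 2 := by field_simp; ring
    rw [e, Real.sqrt_sq (by linarith)]
    ring

/-- `∫_0^∞ F(x) dx = ∫_v^∞ √P (u - v)^{-1/2} F(2√(P(u-v))) du` (`x = 2√(P(u - v))`). [folklore] -/
theorem integral_Ioi_fibreSubst {P v : ℝ} (hP : 0 < P) (F : ℝ → ℝ) :
    ∫ x in Ioi 0, F x =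
      ∫ u in Ioi v, (Real.sqrt P * (u - v) ^ (-(1 / 2 : ℝ))) * F (2 * Real.sqrt (P * (u - v))) := by
  set φ : ℝ → ℝ := fun u => 2 * Real.sqrt (P * (u - v)) with hφ
  set φ' : ℝ → ℝ := fun u => Real.sqrt P * (u - v) ^ (-(1 / 2 : ℝ)) with hφ'
  have hderiv : ∀ u ∈ Ioi v, HasDerivWithinAt φ (φ' u) (Ioi v) u := by
    intro u hu
    have huv : 0 < u - v := by simpa using hu
    have hPuv : 0 < P * (u - v) := mul_pos hP huv
    have h1 : HasDerivAt (fun u => P * (u - v)) P u := by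
      simpa using ((hasDerivAt_id u).sub_const v).const_mul P
    have h2 := (h1.sqrt hPuv.ne').const_mul 2
    refine (h2.congr_deriv ?_).hasDerivWithinAt
    rw [hφ']
    simp only
    rw [Real.sqrt_mul hP.le, Real.rpow_neg huv.le, ← Real.sqrt_eq_rpow]
    have hsP : 0 < Real.sqrt P := Real.sqrt_pos.mpr hP
    have hsuv : 0 < Real.sqrt (u - v) := Real.sqrt_pos.mpr huv
    field_simp
    rw [Real.sq_sqrt hP.le]
  have hinj : InjOn φ (Ioi v) := by
    intro a ha b hb hab
    simp only [hφ] at hab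
    have ha' : 0 ≤ P * (a - v) := (mul_pos hP (by simpa using ha)).le
    have hb' : 0 ≤ P * (b - v) := (mul_pos hP (by simpa using hb)).le
    have := Real.sqrt_inj ha' hb' |>.mp (by linarith)
    nlinarith
  have h := integral_image_eq_integral_abs_deriv_smul measurableSet_Ioi hderiv hinj F
  rw [hφ, image_fibreSubst hP] at h
  rw [h]
  refine setIntegral_congr_fun measurableSet_Ioi fun u hu => ?_
  have huv : 0 < u - v := by simpa using hu
  simp only [hφ', smul_eq_mul]
  rw [abs_of_pos (mul_pos (Real.sqrt_pos.mpr hP) (Real.rpow_pos_of_pos huv _))]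

/-- **The fibre integral of a point-pair invariant kernel** (Iwaniec, proof of Theorem 1.16,
"changing the variable `x = 2√(uy)`"): for `y₀, y > 0` and any real `c`,
`∫_ℝ k(((x - x₀)² + c)/(4 y₀ y)) dx = 2 √(y₀ y) · q(c/(4 y₀ y))` with `q` of (1.62).
[cite: Iwaniec2002, proof of Thm 1.16, PDF p. 24] -/
theorem integral_kernel_fibre (k : ℝ → ℝ) {y₀ y : ℝ} (hy₀ : 0 < y₀) (hy : 0 < y) (x₀ c : ℝ) :
    ∫ x : ℝ, k (((x - x₀) ^ 2 + c) / (4 * y₀ * y)) =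
      2 * Real.sqrt (y₀ * y) * selbergQ k (c / (4 * y₀ * y)) := by
  have hP : 0 < y₀ * y := mul_pos hy₀ hy
  set v : ℝ := c / (4 * y₀ * y) with hv
  -- translation
  have h1 : ∫ x : ℝ, k (((x - x₀) ^ 2 + c) / (4 * y₀ * y)) = ∫ x : ℝ, k ((x ^ 2 + c) / (4 * y₀ * y)) := by
    have := integral_sub_right_eq_self (μ := (volume : Measure ℝ)) (fun x => k ((x ^ 2 + c) / (4 * y₀ * y))) x₀
    simpa using this
  -- evenness
  have h2 : ∫ x : ℝ, k ((x ^ 2 + c) / (4 * y₀ * y)) =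
      2 * ∫ x in Ioi 0, k ((x ^ 2 + c) / (4 * y₀ * y)) := by
    rw [← integral_comp_abs]
    simp_rw [sq_abs]
  rw [h1, h2, integral_Ioi_fibreSubst (v := v) hP]
  have e : ∀ u ∈ Ioi v, Real.sqrt (y₀ * y) * (u - v) ^ (-(1 / 2 : ℝ)) *
      k (((2 * Real.sqrt (y₀ * y * (u - v))) ^ 2 + c) / (4 * y₀ * y)) =
      Real.sqrt (y₀ * y) * (k u * (u - v) ^ (-(1 / 2 : ℝ))) := by
    intro u hu
    have huv : 0 < u - v := by simpa using hu
    have : ((2 * Real.sqrt (y₀ * y * (u - v))) ^ 2 + c) / (4 * y₀ * y) = u := by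
      rw [mul_pow, Real.sq_sqrt (mul_pos hP huv).le, hv]
      field_simp
      ring
    rw [this]; ring
  rw [setIntegral_congr_fun measurableSet_Ioi e, integral_const_mul]
  unfold selbergQ
  ring

end Fibre


/-! ## 4. `L_k y^s = h(t) y^s`: the Selberg/Harish-Chandra transform as the eigenvalue on `(Im w)^s` -/

section Eigenvalue

variable {k : ℝ → ℝ}

/-- `(y₀ e^r - y₀)² / (4 y₀ (y₀ e^r)) = sinh²(r/2)`: the second substitution `y = e^r` of the proof of
Theorem 1.16 turns `q` into `g(r) = 2 q(sinh²(r/2))`. [cite: Iwaniec2002, proof of Thm 1.16, PDF p. 24] -/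
theorem expSubst_arg {y₀ : ℝ} (hy₀ : 0 < y₀) (r : ℝ) :
    (y₀ * Real.exp r - y₀) ^ 2 / (4 * y₀ * (y₀ * Real.exp r)) = Real.sinh (r / 2) ^ 2 := by
  have h2 : Real.exp r = Real.exp (r / 2) ^ 2 := by rw [← Real.exp_nat_mul]; ring_nf
  have hinv : Real.exp (-(r / 2)) * Real.exp (r / 2) = 1 := by rw [← Real.exp_add]; simp
  rw [Real.sinh_eq, h2]
  have he : 0 < Real.exp (r / 2) := Real.exp_pos _
  field_simp
  nlinarith [hinv]

/-- `√(y₀ · y₀ e^r) = y₀ e^{r/2}` for `y₀ > 0`. [folklore] -/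
theorem sqrt_mul_mul_exp {y₀ : ℝ} (hy₀ : 0 < y₀) (r : ℝ) :
    Real.sqrt (y₀ * (y₀ * Real.exp r)) = y₀ * Real.exp (r / 2) := by
  have h2 : y₀ * (y₀ * Real.exp r) = (y₀ * Real.exp (r / 2)) ^ 2 := by
    rw [mul_pow, ← Real.exp_nat_mul]; ring_nf
  rw [h2, Real.sqrt_sq (by positivity)]

/-- `(y₀ e^r)^s = y₀^s e^{rs}` (complex power of a positive real). [folklore] -/
theorem cpow_mul_exp {y₀ : ℝ} (hy₀ : 0 < y₀) (r : ℝ) (s : ℂ) :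
    (((y₀ * Real.exp r : ℝ)) : ℂ) ^ s = ((y₀ : ℝ) : ℂ) ^ s * Complex.exp (r * s) := by
  rw [Complex.ofReal_mul, Complex.mul_cpow_ofReal_nonneg hy₀.le (Real.exp_pos r).le]
  congr 1
  rw [Complex.cpow_def_of_ne_zero (by exact_mod_cast (Real.exp_pos r).ne'), Complex.ofReal_exp,
    Complex.log_exp (by simp [Real.pi_pos]) (by simp [Real.pi_pos.le])]

/-- The pointwise bookkeeping of the substitution `y = y₀ e^r`:
`(y₀e^r) · (y₀e^r)⁻² · (y₀ e^r)^s · 2√(y₀ · y₀e^r) Q = y₀^s e^{r(s - 1/2)} (2Q)`. [folklore] -/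
theorem expSubst_pointwise {y₀ : ℝ} (hy₀ : 0 < y₀) (s : ℂ) (Q r : ℝ) :
    (y₀ * Real.exp r) • ((((y₀ * Real.exp r) ^ 2)⁻¹ : ℝ) •
      ((((y₀ * Real.exp r : ℝ)) : ℂ) ^ s * ((2 * Real.sqrt (y₀ * (y₀ * Real.exp r)) * Q : ℝ) : ℂ))) =
      ((y₀ : ℝ) : ℂ) ^ s * (Complex.exp (r * (s - 1 / 2)) * ((2 * Q : ℝ) : ℂ)) := by
  have hex : Real.exp r = Real.exp (r / 2) ^ 2 := by rw [← Real.exp_nat_mul]; ring_nf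
  have e1 : Complex.exp (r * (s - 1 / 2)) = Complex.exp (r * s) * (((Real.exp (r / 2))⁻¹ : ℝ) : ℂ) := by
    rw [← Real.exp_neg, Complex.ofReal_exp, ← Complex.exp_add]
    congr 1
    push_cast
    ring
  rw [sqrt_mul_mul_exp hy₀, cpow_mul_exp hy₀, e1, hex]
  set E : ℝ := Real.exp (r / 2) with hE
  have hE0 : (E : ℂ) ≠ 0 := by exact_mod_cast (Real.exp_pos (r / 2)).ne'
  have hy : (y₀ : ℂ) ≠ 0 := by exact_mod_cast hy₀.ne'
  rw [Complex.real_smul, Complex.real_smul]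
  push_cast
  field_simp

/-- The substitution `y = y₀ e^r` on `(0, ∞)`: `∫_0^∞ Φ(y) dy = ∫_ℝ y₀ e^r Φ(y₀ e^r) dr`. [folklore] -/
theorem integral_Ioi_expSubst {E : Type*} [NormedAddCommGroup E] [NormedSpace ℝ E] {y₀ : ℝ}
    (hy₀ : 0 < y₀) (Φ : ℝ → E) :
    ∫ y in Ioi 0, Φ y = ∫ r : ℝ, (y₀ * Real.exp r) • Φ (y₀ * Real.exp r) := by
  set φ : ℝ → ℝ := fun r => y₀ * Real.exp r with hφ
  have hderiv : ∀ r ∈ (univ : Set ℝ), HasDerivWithinAt φ (y₀ * Real.exp r) univ r := fun r _ =>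
    ((Real.hasDerivAt_exp r).const_mul y₀).hasDerivWithinAt
  have hinj : InjOn φ univ := by
    intro a _ b _ hab
    have h := mul_left_cancel₀ hy₀.ne' hab
    exact Real.exp_injective h
  have himg : φ '' univ = Ioi 0 := by
    rw [image_univ]
    ext y
    simp only [mem_range, mem_Ioi, hφ]
    constructor
    · rintro ⟨r, rfl⟩; positivity
    · intro hy
      refine ⟨Real.log (y / y₀), ?_⟩
      rw [Real.exp_log (by positivity)]
      field_simp
  have h := integral_image_eq_integral_abs_deriv_smul MeasurableSet.univ hderiv hinj Φ
  rw [himg, Measure.restrict_univ] at h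
  rw [h]
  congr 1 with r
  rw [abs_of_pos (by positivity)]

/-- The `y`-integral of the proof of Theorem 1.16 after the fibre integral:
`∫_0^∞ y⁻² y^s 2√(y₀y) q((y - y₀)²/(4y₀y)) dy = y₀^s ∫_ℝ e^{r(s-1/2)} g(r) dr`. [cite: Iwaniec2002, proof of Thm 1.16, PDF p. 24] -/
theorem integral_Ioi_fibre_eq (k : ℝ → ℝ) {y₀ : ℝ} (hy₀ : 0 < y₀) (s : ℂ) :
    ∫ y in Ioi 0, ((y ^ 2)⁻¹ : ℝ) • (((y : ℝ) : ℂ) ^ s *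
        ((2 * Real.sqrt (y₀ * y) * selbergQ k ((y - y₀) ^ 2 / (4 * y₀ * y)) : ℝ) : ℂ)) =
      ((y₀ : ℝ) : ℂ) ^ s * ∫ r : ℝ, Complex.exp (r * (s - 1 / 2)) * (selbergG k r : ℂ) := by
  rw [integral_Ioi_expSubst hy₀, ← integral_const_mul]
  congr 1 with r
  rw [expSubst_pointwise hy₀ s, expSubst_arg hy₀]
  rfl

/-- `(Im w)^s` is continuous on `ℍ` for every `s ∈ ℂ` (the base is a positive real). [folklore] -/
theorem continuous_im_cpow (s : ℂ) : Continuous fun w : ℍ => ((w.im : ℝ) : ℂ) ^ s := by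
  refine continuous_iff_continuousAt.mpr fun w => ?_
  refine (continuousAt_cpow_const (Or.inl ?_)).comp ?_
  · simpa using w.im_pos
  · exact (Complex.continuous_ofReal.comp UpperHalfPlane.continuous_im).continuousAt

/-- **Theorem 1.16 on the eigenfunction `(Im w)^s`** — the computation at the heart of Iwaniec's
proof of Theorem 1.16 and the integral representation `h(t) = ∫_ℍ k(i, z) y^s dμz` used on p. 73:
for a test kernel `k` and any `t ∈ ℂ`, `s = 1/2 + it`,
`∫_ℍ k(u(z, w)) (Im w)^s dμ(w) = h(t) (Im z)^s`, with `h` the Selberg/Harish-Chandra transform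
(1.62). (Proof as printed: coordinates, the substitution `x = 2√(uy)` — here
`integral_kernel_fibre` — and `y = e^r`.) [cite: Iwaniec2002, Thm 1.16 & proof, PDF p. 24] -/
theorem invariantOperator_im_cpow (hk : IsTestKernel k) (t : ℂ) (z : ℍ) :
    invariantOperator k (fun w => ((w.im : ℝ) : ℂ) ^ ((1 / 2 : ℂ) + Complex.I * t)) z =
      selbergTransform k t * ((z.im : ℝ) : ℂ) ^ ((1 / 2 : ℂ) + Complex.I * t) := by
  set s : ℂ := (1 / 2 : ℂ) + Complex.I * t with hs
  have hz := z.im_pos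
  -- the integrand on `ℍ` and in coordinates
  set F : ℍ → ℂ := fun w => (k (pointPairInv z w) : ℂ) * ((w.im : ℝ) : ℂ) ^ s with hF
  set G : ℂ → ℂ := fun p => ((p.im ^ 2)⁻¹ : ℝ) •
    ((k (((p.re - z.re) ^ 2 + (p.im - z.im) ^ 2) / (4 * z.im * p.im)) : ℂ) * ((p.im : ℝ) : ℂ) ^ s) with hG
  have hFG : ∀ p ∈ {p : ℂ | 0 < p.im}, ((p.im ^ 2)⁻¹ : ℝ) • F (ofComplex p) = G p := by
    intro p hp
    have hp' : 0 < p.im := hp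
    simp only [hF, hG, pointPairInv_ofComplex z hp']
    rw [ofComplex_apply_of_im_pos hp']
    rfl
  have hFi : Integrable F := integrable_kernel_mul_of_continuous hk (continuous_im_cpow s) z
  have hGi : IntegrableOn G {p : ℂ | 0 < p.im} :=
    ((integrable_upperHalfPlane_iff_integrableOn_complex F).mp hFi).congr_fun hFG
      (isOpen_upperHalfPlaneSet.measurableSet)
  unfold invariantOperator
  rw [show (fun w : ℍ => (k (pointPairInv z w) : ℂ) * ((w.im : ℝ) : ℂ) ^ s) = F from rfl,
    integral_upperHalfPlane_eq_integral_complex F,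
    setIntegral_congr_fun isOpen_upperHalfPlaneSet.measurableSet hFG,
    setIntegral_upperHalf_eq_iterated G hGi]
  -- the fibre integrals
  have hfib : ∀ y ∈ Ioi (0 : ℝ), ∫ x : ℝ, G ⟨x, y⟩ = ((y ^ 2)⁻¹ : ℝ) • (((y : ℝ) : ℂ) ^ s *
      ((2 * Real.sqrt (z.im * y) * selbergQ k ((y - z.im) ^ 2 / (4 * z.im * y)) : ℝ) : ℂ)) := by
    intro y hy
    have hy' : 0 < y := hy
    simp only [hG]
    rw [integral_smul, integral_mul_const, integral_complex_ofReal, integral_kernel_fibre k hz hy']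
    ring_nf
  rw [setIntegral_congr_fun measurableSet_Ioi hfib, integral_Ioi_fibre_eq k hz s, mul_comm]
  congr 1
  unfold selbergTransform
  congr 1 with r
  congr 1
  rw [hs]
  ring_nf

/-- The integral representation of the Selberg/Harish-Chandra transform (Iwaniec, p. 73, "as in
the proof of Theorem 1.16"): `h(t) = ∫_ℍ k(u(i, w)) (Im w)^{1/2 + it} dμ(w)`.
[cite: Iwaniec2002, §7.2, PDF p. 73] -/
theorem selbergTransform_eq_integral (hk : IsTestKernel k) (t : ℂ) :
    selbergTransform k t =
      ∫ w : ℍ, (k (pointPairInv UpperHalfPlane.I w) : ℂ) * ((w.im : ℝ) : ℂ) ^ ((1 / 2 : ℂ) + Complex.I * t) := by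
  have h := invariantOperator_im_cpow hk t UpperHalfPlane.I
  rw [UpperHalfPlane.I_im] at h
  simp only [Complex.ofReal_one, Complex.one_cpow, mul_one] at h
  rw [← h]
  rfl

/-- **Theorem 1.16 on `(Im g w)^s`** for `g ∈ SL₂(ℝ)` — the general term of Eisenstein and
Poincaré series: `L_k (Im g·)^{1/2+it} = h(t) (Im g·)^{1/2+it}` (invariance of `L_k`).
[cite: Iwaniec2002, Thm 1.16, PDF p. 24] -/
theorem invariantOperator_im_smul_cpow (hk : IsTestKernel k) (g : SL(2, ℝ)) (t : ℂ) (z : ℍ) :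
    invariantOperator k (fun w => (((g • w).im : ℝ) : ℂ) ^ ((1 / 2 : ℂ) + Complex.I * t)) z =
      selbergTransform k t * (((g • z).im : ℝ) : ℂ) ^ ((1 / 2 : ℂ) + Complex.I * t) := by
  rw [invariantOperator_comp_smul k (fun w : ℍ => ((w.im : ℝ) : ℂ) ^ ((1 / 2 : ℂ) + Complex.I * t)) g z]
  exact invariantOperator_im_cpow hk t (g • z)

/-- **The hyperbolic area integral of a point-pair invariant** (`s = 0`, `t = i/2`, on p. 73:
"`h(i/2) = ∫_ℍ k(i, z) dμz`", combined with `h(i/2) = 4π ∫_0^∞ k`): for a test kernel,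
`∫_ℍ k(u(z, w)) dμ(w) = 4π ∫_0^∞ k(u) du` at every `z`. This is the eigenvalue of `L_k` on constants,
the source of the main term of Theorem 12.1. [cite: Iwaniec2002, §7.2, PDF p. 73 & Thm 1.16, PDF p. 24] -/
theorem integral_kernel_eq (hk : IsTestKernel k) (z : ℍ) :
    ∫ w : ℍ, (k (pointPairInv z w) : ℂ) = ((4 * π * ∫ u in Ioi 0, k u : ℝ) : ℂ) := by
  have h := invariantOperator_im_cpow hk (Complex.I / 2) z
  have hs : (1 / 2 : ℂ) + Complex.I * (Complex.I / 2) = 0 := by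
    rw [show Complex.I * (Complex.I / 2) = Complex.I * Complex.I / 2 by ring, Complex.I_mul_I]; ring
  rw [hs] at h
  simp only [Complex.cpow_zero, mul_one] at h
  rw [selbergTransform_I_half hk] at h
  rw [← h]
  unfold invariantOperator
  simp

/-- Real form: `∫_ℍ k(u(z, w)) dμ(w) = 4π ∫_0^∞ k`. [cite: Iwaniec2002, §7.2, PDF p. 73] -/
theorem integral_kernel_eq_real (hk : IsTestKernel k) (z : ℍ) :
    ∫ w : ℍ, k (pointPairInv z w) = 4 * π * ∫ u in Ioi 0, k u := by
  have h := integral_kernel_eq hk z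
  rw [integral_complex_ofReal] at h
  exact_mod_cast h

/-- `L_k 1 = 4π ∫_0^∞ k` (constants are eigenfunctions, eigenvalue `h(i/2)`).
[cite: Iwaniec2002, §7.2, PDF p. 73] -/
theorem invariantOperator_const (hk : IsTestKernel k) (c : ℂ) (z : ℍ) :
    invariantOperator k (fun _ => c) z = ((4 * π * ∫ u in Ioi 0, k u : ℝ) : ℂ) * c := by
  unfold invariantOperator
  rw [integral_mul_const, integral_kernel_eq hk z]

end Eigenvalue

end Literature.NumberTheory.Automorphic
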